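import Literature.MathematicalPhysics.QuantumFieldTheory.Balaban1983to89.B9RWSums346MixedFactorFromLegs

/-!
# `Balaban1983to89.B9RWSums343HolderVFromLegs` — T. Bałaban, *Propagators for lattice gauge theories in a background field*, Commun. Math. Phys. **99**
# (1985) 389–434 [Balaban1985BackgroundPropagators] (3.43) p. 398 with (3.88)–(3.89) p. 409, (3.100) p. 413 and [4] (2.39)–(2.44) pp. 229–230, (2.52)–(2.55) p. 232:
# THE TRANSPOSED THIRD-ORDER FACTOR `h_□G′_□K(h_□)ᵗ` OF ROWS 18 READ THROUGH THE HÖLDER PROBES — the schema `B9Thm37KLetterDir.HolderV37Dir` DERIVED (not posited) from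
# the transposed letters' SUP majorants (`Identities₂.hPt ∕ hCt`, column weights of `StaticOK`) and two letter-free PROBE legs of the local propagator `G′_□`

statement-level skeleton of published theorems with citation tags; proofs where landed; nothing here is a claim about the Yang–Mills mass gap

THE PRINT.  (3.43) p. 398: *«‖ζ∇_UG′(U)λ‖_β, ‖ζG′(U)∇\*_Uλ‖_β ≦ B₀[(Lʲη)^{1−β}, …]·(‖ζ‖^ξ_β + |ζ|)·e^{−δ₀d(y,y′)}|λ|»* (Hölder probes); (3.88) p. 409 and its transpose
`G′₀Δ′_a = I − Σ_□h_□G′_□(Σ_μ∇\*_{U,μ}Pᵗ_{□,μ} + Cᵗ_□)` (`B9Thm37WholeDir.Identities₂.eq388T`, `K(h_□)ᵗ = KoptDir`); [4] (2.41)–(2.44) p. 230 (the coefficient sizes, here as the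
COLUMN weights `Σ_{y″}KPt(y″,b)·L^{j_b}η ≦ 1_{S′}(b)·kPt`, `Σ_{y″}KCt(y″,b)·(L^{j_b}η)² ≦ 1_{S′}(b)·kCt` of `B9Thm37Whole.StaticOK`).

WHY THIS FILE (cell `pub-ymgap`, Track A node N06 [B9], rows 18; width seat `pub-ymgap-dag-n06-w7`, g1, 2026-08-28).  Third of this seat's three K-letter files: the N06
certificate's rows-18 binder `h36H` DISPLAYS `HolderV37Dir (𝔬 x) (𝔡 x) (𝔩 x) (𝔭 x) 1 (H x) p.Bt p.δ₀ U` — `HasMajorantHom blk blkPX (Φ^X_β ∘ (M_{h_□}·G′_□·K(h_□)ᵗ))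
(1_{S′_□}(y′)·B_V(β)·(L^{j_y}η)^{1−β}(L^{j_{y′}}η)⁻¹·e^{−δ₀d})`.  With `K(h_□)ᵗ = Σ_μ ∇\*_{U,μ}Pᵗ_{□,μ} + Cᵗ_□` the letters now sit on the SOURCE side and compose through their
displayed sup majorants and COLUMN weights — no transposes, no Schur, and for the `Pᵗ`-terms not even a scale transfer:
* §1 ★ `hasMajorantHom_leg_comp_localLetter`: a leg `S` with majorant `a(y)·(L^{j_z}η)^q·e^{−δ₁d(y,z)}` into any probe blocks AFTER a letter `T` with a LOCAL sup majorant `K ≧ 0`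
  (range `ρ`, column weights `(Σ_z K(z,b))·(L^{j_b}η)^m ≦ 1_S(b)·k`) has the majorant `1_S(y′)·a(y)·(k·L₀^{|q|}·e^{(αδ+δ₁)ρ})·(L^{j_{y′}}η)^{q−m}·e^{−δ₁d(y,y′)}`
  (`B6RandomWalkHom.hasMajorantHom_comp`; the leg's scale at `z` moves to `y′` inside the range, the decay factor by the triangle inequality).
* §2 `phiX_mulOp_Gsq_koptDir_eq` (the algebra) and ★★ `holderV37Dir_of_probeLegs`: `Identities₂` (`hPt`, `KPtd_nonneg`, `KPtd_sum`, `hCt`), `StaticOK` (`KPt_col∕KPt_loc∕KPt_nonneg`,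
  `KCt_col∕KCt_loc∕KCt_nonneg`), `Facts347`, `0 ≤ αδ`, `0 ≤ δ₁`, and two UNCUT PROBE LEGS per `0 ≤ β < 1` — `hDsdH : ∀ i μ, HasMajorantHom blk blkPX (Φ^X_β ∘ ((M_{h_i}·G′_i) ∘ ∇\*_μ))
  (B_H(β)·(L^{j_y}η)^{1−β}·e^{−δ₁d})` and `hZeroH : ∀ i, HasMajorantHom blk blkPX (Φ^X_β ∘ (M_{h_i}·G′_i)) (B_0(β)·(L^{j_y}η)^{1−β}·(L^{j_z}η)·e^{−δ₁d})` ⊢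
  `HolderV37Dir 𝔬 𝔡 𝔩 𝔭 R H (fun β => (|Dir|·kPt·B_H(β) + kCt·B_0(β)·L₀)·e^{(αδ+δ₁)ρ}) δ₁ U`.
HONEST NOTE.  The probe legs have no 𝔸-level producer in the tree today (print's Hölder estimates (3.43) for `G′_□` are not typed); the gain is that the abstract K-letter
leaves this displayed analytic binder as well — after this file and its two siblings NO rows-18 schema of the certificate mentions `K(h_□)` except through the kinematic
majorants of `Identities₂`.  Majorant bookkeeping over landed modules; hypotheses as displayed; nothing of [B9] asserted; COUNT-NEUTRAL; N06 NOT discharged; nothing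
continuum ∕ OS ∕ mass gap ∕ Clay.  NEW file; nothing landed is modified; net new unproved facts: 0; 0 `def`.
-/

namespace Literature.MathematicalPhysics.QuantumFieldTheory.Balaban1983to89.B9RWSums343HolderVFromLegs

open Literature.MathematicalPhysics.QuantumFieldTheory.Balaban1983to89
open Finset B6RandomWalk B6RandomWalkHom B9Thm37Sum B9Thm34Ext B9Thm37Glue B9Thm37Whole
open B9RWSums343to347Whole B9RWSums346Schur B11SectG B9SectDL2Decay B9RWSums346SecondDiffGp B9RWSums343Holder
open B9Thm37WholeDir B9Thm37KLetterDir B9Ineq347 B9RWSums346MixedFactorFromLegs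

noncomputable section

/-! ## §1 `HasMajorantHom` bookkeeping and the composition leg-after-local-letter -/

section Bookkeeping

variable {g : B9.Geometry} [Fintype g.Site] [DecidableEq g.Site] {R : ℝ} {H : Prop} {X PX : Type}

omit [DecidableEq g.Site] in
/-- two-space majorants of a finite sum of operators: the kernels add. [cite: Balaban1984PropagatorsII, (2.52)–(2.55) p.232, bookkeeping] -/
theorem hasMajorantHom_finsetSum {κ' : Type} (s : Finset κ') (blk : X → g.Site) (blkP : PX → g.Site) (T : κ' → (X → ℝ) →ₗ[ℝ] (PX → ℝ))
    (K : κ' → g.Site → g.Site → ℝ) (h : ∀ k ∈ s, HasMajorantHom (g := toB6 g R H) blk blkP (T k) (K k)) :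
    HasMajorantHom (g := toB6 g R H) blk blkP (∑ k ∈ s, T k) (fun a b => ∑ k ∈ s, K k a b) := by
  classical
  induction s using Finset.induction_on with
  | empty => simpa only [Finset.sum_empty] using hasMajorantHom_zero (g := toB6 g R H) blk blkP
  | insert k s hk ih =>
      have hk' := h k (Finset.mem_insert_self k s)
      have hs' := ih fun j hj => h j (Finset.mem_insert_of_mem hj)
      rw [Finset.sum_insert hk]
      exact hasMajorantHom_mono (g := toB6 g R H) blk blkP (hasMajorantHom_add (g := toB6 g R H) blk blkP hk' hs') fun a b => by rw [Finset.sum_insert hk]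

/-- ★ **A LEG INTO THE PROBE BLOCKS AFTER A LOCAL SUP-MAJORISED LETTER**: `S` with the majorant `a(y)·(L^{j_z}η)^q·e^{−δ₁d(y,z)}` (`a ≧ 0`) from the blocks of `blk` into those of
`blkP`, after `T` with a sup majorant `K ≧ 0` of range `ρ` and column weights `(Σ_z K(z,b))·(L^{j_b}η)^m ≦ 1_S(b)·k`, has the majorant
`1_S(y′)·a(y)·(k·L₀^{|q|}·e^{(αδ+δ₁)ρ})·(L^{j_{y′}}η)^{q−m}·e^{−δ₁d(y,y′)}` (`|q| ≦ 4`, `0 ≦ αδ`, `0 ≦ δ₁`). [cite: Balaban1985BackgroundPropagators, (3.43) p.398 + remark after (3.47) p.398 + (3.89) p.409; Balaban1984PropagatorsII, (2.41)–(2.44) p.230 + (2.52)–(2.55) p.232] -/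
theorem hasMajorantHom_leg_comp_localLetter (blk : X → g.Site) (blkP : PX → g.Site) {S : (X → ℝ) →ₗ[ℝ] (PX → ℝ)} {T : Module.End ℝ (X → ℝ)}
    {K : g.Site → g.Site → ℝ} (Sset : Finset g.Site) {d : ℕ} {δ α L₀ k ρ q m δ₁ : ℝ} (a : g.Site → ℝ) (ha : ∀ y, 0 ≤ a y) (hF : Facts347 g R H d δ α L₀)
    (htri : ∀ x y z : g.Site, g.dist x z ≤ g.dist x y + g.dist y z) (hsymm : ∀ y y' : g.Site, g.dist y y' = g.dist y' y) (hlen : ∀ y : g.Site, 0 < g.len y)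
    (hαδ : 0 ≤ α * δ) (hδ₁ : 0 ≤ δ₁) (hq : |q| ≤ 4)
    (hK0 : ∀ z b, 0 ≤ K z b) (hKloc : ∀ z b, K z b ≠ 0 → g.dist z b ≤ ρ) (hKcol : ∀ b, (∑ z : g.Site, K z b) * g.len b ^ m ≤ if b ∈ Sset then k else 0)
    (hS : HasMajorantHom (g := toB6 g R H) blk blkP S (fun (y z : g.Site) => a y * g.len z ^ q * Real.exp (-(δ₁ * g.dist y z))))
    (hT : HasMajorant (g := toB6 g R H) blk T K) :
    HasMajorantHom (g := toB6 g R H) blk blkP (S ∘ₗ T)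
      (fun (y y' : g.Site) => (if y' ∈ Sset then (1 : ℝ) else 0) * a y * (k * L₀ ^ |q| * Real.exp ((α * δ + δ₁) * ρ)) * g.len y' ^ (q - m) *
        Real.exp (-(δ₁ * g.dist y y'))) := by
  have hlen0 : ∀ y : g.Site, 0 ≤ g.len y := fun y => (hlen y).le
  have hL0 : 0 ≤ g.L := zero_le_one.trans hF.one_le_L
  have hL₀ : 0 ≤ L₀ := hL0.trans hF.L_le
  have hcomp := hasMajorantHom_comp (g := toB6 g R H) blk blk blkP hS ((hasMajorantHom_iff _ _ _).mpr hT) hK0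
  refine hasMajorantHom_mono (g := toB6 g R H) blk blkP hcomp fun y y' => ?_
  -- termwise: inside the range, move the leg's scale at `z` to `y′` and the decay factor to `d(y,y′)`
  have hterm : ∀ z : g.Site, (a y * g.len z ^ q * Real.exp (-(δ₁ * g.dist y z))) * K z y'
      ≤ (a y * (L₀ ^ |q| * Real.exp ((α * δ + δ₁) * ρ)) * g.len y' ^ q * Real.exp (-(δ₁ * g.dist y y'))) * K z y' := by
    intro z
    by_cases hKz : K z y' = 0
    · rw [hKz, mul_zero, mul_zero]
    have hd : g.dist z y' ≤ ρ := hKloc z y' hKz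
    have hd' : g.dist y' z ≤ ρ := by rw [hsymm]; exact hd
    -- the scale transfer at distance ≤ ρ: (L^{j_z}η)^q ≤ L^{|q|}·e^{αδ d(y′,z)}·(L^{j_{y′}}η)^q
    have hst : Real.exp (-(α * δ * g.dist y' z)) * g.len z ^ q ≤ g.L ^ |q| * g.len y' ^ q := scaleTransfer_len_rpow hF q hq y' z
    have htr : g.len z ^ q ≤ L₀ ^ |q| * Real.exp (α * δ * ρ) * g.len y' ^ q := by
      have h1 : g.len z ^ q ≤ Real.exp (α * δ * g.dist y' z) * (g.L ^ |q| * g.len y' ^ q) := by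
        have h := mul_le_mul_of_nonneg_left hst (Real.exp_nonneg (α * δ * g.dist y' z))
        rwa [← mul_assoc, ← Real.exp_add, show α * δ * g.dist y' z + -(α * δ * g.dist y' z) = 0 by ring, Real.exp_zero, one_mul] at h
      have h2 : Real.exp (α * δ * g.dist y' z) ≤ Real.exp (α * δ * ρ) := Real.exp_le_exp.mpr (mul_le_mul_of_nonneg_left hd' hαδ)
      have h3 : g.L ^ |q| ≤ L₀ ^ |q| := Real.rpow_le_rpow hL0 hF.L_le (abs_nonneg _)
      calc g.len z ^ q ≤ Real.exp (α * δ * g.dist y' z) * (g.L ^ |q| * g.len y' ^ q) := h1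
        _ ≤ Real.exp (α * δ * ρ) * (L₀ ^ |q| * g.len y' ^ q) :=
            mul_le_mul h2 (mul_le_mul_of_nonneg_right h3 (Real.rpow_nonneg (hlen0 y') _)) (mul_nonneg (Real.rpow_nonneg hL0 _) (Real.rpow_nonneg (hlen0 y') _))
              (Real.exp_nonneg _)
        _ = L₀ ^ |q| * Real.exp (α * δ * ρ) * g.len y' ^ q := by ring
    -- the decay factor: d(y,y′) ≤ d(y,z) + d(z,y′) ≤ d(y,z) + ρ
    have hdec : Real.exp (-(δ₁ * g.dist y z)) ≤ Real.exp (δ₁ * ρ) * Real.exp (-(δ₁ * g.dist y y')) := by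
      rw [← Real.exp_add]
      exact Real.exp_le_exp.mpr (by nlinarith [htri y z y', hd, hδ₁])
    have hprod := mul_le_mul htr hdec (Real.exp_nonneg _) (mul_nonneg (mul_nonneg (Real.rpow_nonneg hL₀ _) (Real.exp_nonneg _)) (Real.rpow_nonneg (hlen0 y') _))
    have hK := hK0 z y'
    calc (a y * g.len z ^ q * Real.exp (-(δ₁ * g.dist y z))) * K z y' = a y * (g.len z ^ q * Real.exp (-(δ₁ * g.dist y z))) * K z y' := by ring
      _ ≤ a y * ((L₀ ^ |q| * Real.exp (α * δ * ρ) * g.len y' ^ q) * (Real.exp (δ₁ * ρ) * Real.exp (-(δ₁ * g.dist y y')))) * K z y' :=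
          mul_le_mul_of_nonneg_right (mul_le_mul_of_nonneg_left hprod (ha y)) hK
      _ = (a y * (L₀ ^ |q| * (Real.exp (α * δ * ρ) * Real.exp (δ₁ * ρ))) * g.len y' ^ q * Real.exp (-(δ₁ * g.dist y y'))) * K z y' := by ring
      _ = (a y * (L₀ ^ |q| * Real.exp ((α * δ + δ₁) * ρ)) * g.len y' ^ q * Real.exp (-(δ₁ * g.dist y y'))) * K z y' := by rw [← Real.exp_add]; congr 3; ring
  have hcol := hKcol y'
  have hfac0 : 0 ≤ a y * (L₀ ^ |q| * Real.exp ((α * δ + δ₁) * ρ)) * g.len y' ^ q * Real.exp (-(δ₁ * g.dist y y')) :=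
    mul_nonneg (mul_nonneg (mul_nonneg (ha y) (mul_nonneg (Real.rpow_nonneg hL₀ _) (Real.exp_nonneg _))) (Real.rpow_nonneg (hlen0 y') _)) (Real.exp_nonneg _)
  have hym : 0 < g.len y' ^ m := Real.rpow_pos_of_pos (hlen y') m
  -- `Σ_z K(z,y′) ≤ 1_S(y′)·k·(L^{j_{y′}}η)^{−m}`
  have hsumK : ∑ z : g.Site, K z y' ≤ (if y' ∈ Sset then k else 0) * g.len y' ^ (-m) := by
    rw [Real.rpow_neg (hlen0 y'), ← div_eq_mul_inv, le_div_iff₀ hym]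
    exact hcol
  calc ∑ z : g.Site, (a y * g.len z ^ q * Real.exp (-(δ₁ * g.dist y z))) * K z y'
      ≤ ∑ z : g.Site, (a y * (L₀ ^ |q| * Real.exp ((α * δ + δ₁) * ρ)) * g.len y' ^ q * Real.exp (-(δ₁ * g.dist y y'))) * K z y' :=
        Finset.sum_le_sum fun z _ => hterm z
    _ = (a y * (L₀ ^ |q| * Real.exp ((α * δ + δ₁) * ρ)) * g.len y' ^ q * Real.exp (-(δ₁ * g.dist y y'))) * ∑ z : g.Site, K z y' := by rw [Finset.mul_sum]
    _ ≤ (a y * (L₀ ^ |q| * Real.exp ((α * δ + δ₁) * ρ)) * g.len y' ^ q * Real.exp (-(δ₁ * g.dist y y'))) * ((if y' ∈ Sset then k else 0) * g.len y' ^ (-m)) :=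
        mul_le_mul_of_nonneg_left hsumK hfac0
    _ = (if y' ∈ Sset then (1 : ℝ) else 0) * a y * (k * L₀ ^ |q| * Real.exp ((α * δ + δ₁) * ρ)) * (g.len y' ^ q * g.len y' ^ (-m)) *
          Real.exp (-(δ₁ * g.dist y y')) := by split_ifs <;> ring
    _ = (if y' ∈ Sset then (1 : ℝ) else 0) * a y * (k * L₀ ^ |q| * Real.exp ((α * δ + δ₁) * ρ)) * g.len y' ^ (q - m) * Real.exp (-(δ₁ * g.dist y y')) := by
        rw [← Real.rpow_add (hlen y'), sub_eq_add_neg]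

end Bookkeeping

/-! ## §2 The probed transposed factor `h_□G′_□K(h_□)ᵗ` from the transposed letters' sup majorants and the uncut probe legs -/

section HolderV

variable {g : B9.Geometry} [Fintype g.Site] [DecidableEq g.Site] {R : ℝ} {H : Prop} {B : B9.Backgrounds}
variable {X Y ι Dir PX PY : Type} [Fintype ι] [Fintype Dir]

omit [Fintype g.Site] [DecidableEq g.Site] [Fintype ι] in
/-- **THE ALGEBRA OF THE TRANSPOSED FACTOR**: `Φ ∘ (M_h·G′_□·K(h_□)ᵗ) = Σ_μ (Φ ∘ ((M_h·G′_□) ∘ ∇\*_μ)) ∘ Pᵗ_{□,μ} + (Φ ∘ (M_h·G′_□)) ∘ Cᵗ_□`, `K(h_□)ᵗ = Σ_μ ∇\*_{U,μ}Pᵗ_{□,μ} + Cᵗ_□`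
(`KoptDir`). [cite: Balaban1985BackgroundPropagators, (3.88) p.409 (transposed); Balaban1984PropagatorsII, (2.39)–(2.40) pp.229–230] -/
theorem phiX_mulOp_Gsq_koptDir_eq (𝔬 : Ops g B X Y ι) (𝔡 : DirOps37 𝔬 Dir) (𝔩 : DirLetters37 𝔬 Dir) (Φ : (X → ℝ) →ₗ[ℝ] (PX → ℝ)) (U : B.Cfg) (i : ι) :
    Φ ∘ₗ (mulOp (𝔬.h i) * 𝔬.Gsq U i * KoptDir 𝔬 𝔡 𝔩 U i) =
      (∑ μ, (Φ ∘ₗ ((mulOp (𝔬.h i) * 𝔬.Gsq U i) ∘ₗ 𝔡.Dsd U μ)) ∘ₗ 𝔩.Pt U i μ) + (Φ ∘ₗ (mulOp (𝔬.h i) * 𝔬.Gsq U i)) ∘ₗ 𝔬.Ct U i := by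
  apply LinearMap.ext
  intro f
  simp only [KoptDir, LinearMap.comp_apply, LinearMap.add_apply, LinearMap.sum_apply, Module.End.mul_apply, map_sum, map_add]

/-- ★★ **ROWS 18's PROBED TRANSPOSED FACTOR SCHEMA DERIVED**: the transposed letters' displayed sup majorants (`Identities₂.hPt` with `KPtd_sum`, `Identities₂.hCt`), their column weights and
ranges (`StaticOK.KPt_col ∕ KPt_loc`, `KCt_col ∕ KCt_loc`), `Facts347` and, for every `0 ≤ β < 1`, the two UNCUT PROBE LEGS of the cube operator — `hDsdH` (`Φ^X_β ∘ (M_{h_i}G′_i∇\*_μ)`,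
majorant `B_H(β)·(L^{j_y}η)^{1−β}·e^{−δ₁d}`) and `hZeroH` (`Φ^X_β ∘ (M_{h_i}G′_i)`, majorant `B_0(β)·(L^{j_y}η)^{1−β}·(L^{j_z}η)·e^{−δ₁d}`) — give
`HolderV37Dir 𝔬 𝔡 𝔩 𝔭 R H (fun β => (|Dir|·kPt·B_H(β) + kCt·B_0(β)·L₀)·e^{(αδ+δ₁)ρ}) δ₁ U`.  No transposes, no Schur: the letters sit on the source side.
[cite: Balaban1985BackgroundPropagators, (3.88)–(3.89) p.409 + (3.43) p.398 + (3.100) p.413 + remark after (3.47) p.398; Balaban1984PropagatorsII, (2.39)–(2.44) pp.229–230 + (2.52)–(2.55) p.232] -/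
theorem holderV37Dir_of_probeLegs (𝔬 : Ops g B X Y ι) (𝔡 : DirOps37 𝔬 Dir) (𝔩 : DirLetters37 𝔬 Dir) (𝔭 : HolderProbes g B X Y PX PY) (R : ℝ) (H : Prop)
    (d : ℕ) (δ α L₀ ρ N N' Cℓ δ₁ : ℝ) (BH B0 : ℝ → ℝ) (κ : Sizes) (U : B.Cfg)
    (hBH : ∀ β, 0 ≤ β → β < 1 → 0 ≤ BH β) (hB0 : ∀ β, 0 ≤ β → β < 1 → 0 ≤ B0 β) (hαδ : 0 ≤ α * δ) (hδ₁ : 0 ≤ δ₁)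
    (hs : StaticOK 𝔬 ρ N N' Cℓ κ) (hF : Facts347 g R H d δ α L₀) (hi : Identities₂ 𝔬 𝔡 𝔩 R H U)
    (hDsdH : ∀ β : ℝ, 0 ≤ β → β < 1 → ∀ (i : ι) (μ : Dir), HasMajorantHom (g := toB6 g R H) 𝔬.blk 𝔭.blkPX
      (𝔭.ΦX U β ∘ₗ ((mulOp (𝔬.h i) * 𝔬.Gsq U i) ∘ₗ 𝔡.Dsd U μ)) (fun (y z : g.Site) => BH β * g.len y ^ (1 - β) * Real.exp (-(δ₁ * g.dist y z))))
    (hZeroH : ∀ β : ℝ, 0 ≤ β → β < 1 → ∀ i : ι, HasMajorantHom (g := toB6 g R H) 𝔬.blk 𝔭.blkPX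
      (𝔭.ΦX U β ∘ₗ (mulOp (𝔬.h i) * 𝔬.Gsq U i)) (fun (y z : g.Site) => B0 β * g.len y ^ (1 - β) * g.len z ^ (1 : ℝ) * Real.exp (-(δ₁ * g.dist y z)))) :
    HolderV37Dir 𝔬 𝔡 𝔩 𝔭 R H (fun β => ((Fintype.card Dir : ℝ) * (κ.kPt * BH β) + κ.kCt * B0 β * L₀) * Real.exp ((α * δ + δ₁) * ρ)) δ₁ U := by
  classical
  have hlen0 : ∀ y : g.Site, 0 ≤ g.len y := fun y => (hs.lenpos y).le
  refine ⟨fun β hβ0 hβ1 i => ?_⟩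
  -- the Pᵗ-terms: per direction, the probe leg with `∇*_μ` (`q = 0`) after the letter `Pᵗ_{i,μ}` (kernel `KPtd i μ ≤ KPt i`, column weight `m = 1`)
  have hPcol : ∀ (μ : Dir) (b : g.Site), (∑ z : g.Site, 𝔩.KPtd i μ z b) * g.len b ^ (1 : ℝ) ≤ if b ∈ 𝔬.S' i then κ.kPt else 0 := by
    intro μ b
    have hle : ∀ z, 𝔩.KPtd i μ z b ≤ 𝔬.KPt i z b := fun z =>
      (Finset.single_le_sum (f := fun μ' => 𝔩.KPtd i μ' z b) (fun μ' _ => hi.KPtd_nonneg i μ' z b) (Finset.mem_univ μ)).trans (hi.KPtd_sum i z b)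
    rw [Real.rpow_one]
    exact (mul_le_mul_of_nonneg_right (Finset.sum_le_sum fun z _ => hle z) (hlen0 b)).trans (hs.KPt_col i b)
  have hPloc : ∀ (μ : Dir) (z b : g.Site), 𝔩.KPtd i μ z b ≠ 0 → g.dist z b ≤ ρ := by
    intro μ z b hzb
    refine hs.KPt_loc i z b fun h0 => hzb (le_antisymm ?_ (hi.KPtd_nonneg i μ z b))
    exact (Finset.single_le_sum (f := fun μ' => 𝔩.KPtd i μ' z b) (fun μ' _ => hi.KPtd_nonneg i μ' z b) (Finset.mem_univ μ)).trans ((hi.KPtd_sum i z b).trans h0.le)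
  have hPterm : ∀ μ : Dir, HasMajorantHom (g := toB6 g R H) 𝔬.blk 𝔭.blkPX ((𝔭.ΦX U β ∘ₗ ((mulOp (𝔬.h i) * 𝔬.Gsq U i) ∘ₗ 𝔡.Dsd U μ)) ∘ₗ 𝔩.Pt U i μ)
      (fun (y y' : g.Site) => (if y' ∈ 𝔬.S' i then (1 : ℝ) else 0) * (BH β * g.len y ^ (1 - β)) * (κ.kPt * L₀ ^ |(0 : ℝ)| * Real.exp ((α * δ + δ₁) * ρ)) *
        g.len y' ^ ((0 : ℝ) - 1) * Real.exp (-(δ₁ * g.dist y y'))) := by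
    intro μ
    have hleg : HasMajorantHom (g := toB6 g R H) 𝔬.blk 𝔭.blkPX (𝔭.ΦX U β ∘ₗ ((mulOp (𝔬.h i) * 𝔬.Gsq U i) ∘ₗ 𝔡.Dsd U μ))
        (fun (y z : g.Site) => (BH β * g.len y ^ (1 - β)) * g.len z ^ (0 : ℝ) * Real.exp (-(δ₁ * g.dist y z))) :=
      hasMajorantHom_mono (g := toB6 g R H) _ _ (hDsdH β hβ0 hβ1 i μ) fun y z => by rw [Real.rpow_zero, mul_one]
    exact hasMajorantHom_leg_comp_localLetter (R := R) (H := H) 𝔬.blk 𝔭.blkPX (𝔬.S' i) (m := (1 : ℝ)) (fun y => BH β * g.len y ^ (1 - β))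
      (fun y => mul_nonneg (hBH β hβ0 hβ1) (Real.rpow_nonneg (hlen0 y) _)) hF hs.tri hs.symm hs.lenpos hαδ hδ₁ (by rw [abs_zero]; norm_num)
      (fun z b => hi.KPtd_nonneg i μ z b) (hPloc μ) (hPcol μ) hleg (hi.hPt i μ)
  -- the Cᵗ-term: the plain probe leg (`q = 1`) after the letter `Cᵗ_i` (kernel `KCt i`, column weight `m = 2`)
  have hCcol : ∀ b : g.Site, (∑ z : g.Site, 𝔬.KCt i z b) * g.len b ^ (2 : ℝ) ≤ if b ∈ 𝔬.S' i then κ.kCt else 0 := by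
    intro b; rw [Real.rpow_two]; exact hs.KCt_col i b
  have hCterm : HasMajorantHom (g := toB6 g R H) 𝔬.blk 𝔭.blkPX ((𝔭.ΦX U β ∘ₗ (mulOp (𝔬.h i) * 𝔬.Gsq U i)) ∘ₗ 𝔬.Ct U i)
      (fun (y y' : g.Site) => (if y' ∈ 𝔬.S' i then (1 : ℝ) else 0) * (B0 β * g.len y ^ (1 - β)) * (κ.kCt * L₀ ^ |(1 : ℝ)| * Real.exp ((α * δ + δ₁) * ρ)) *
        g.len y' ^ ((1 : ℝ) - 2) * Real.exp (-(δ₁ * g.dist y y'))) := by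
    have hleg : HasMajorantHom (g := toB6 g R H) 𝔬.blk 𝔭.blkPX (𝔭.ΦX U β ∘ₗ (mulOp (𝔬.h i) * 𝔬.Gsq U i))
        (fun (y z : g.Site) => (B0 β * g.len y ^ (1 - β)) * g.len z ^ (1 : ℝ) * Real.exp (-(δ₁ * g.dist y z))) :=
      hasMajorantHom_mono (g := toB6 g R H) _ _ (hZeroH β hβ0 hβ1 i) fun y z => le_of_eq (by ring)
    exact hasMajorantHom_leg_comp_localLetter (R := R) (H := H) 𝔬.blk 𝔭.blkPX (𝔬.S' i) (m := (2 : ℝ)) (fun y => B0 β * g.len y ^ (1 - β))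
      (fun y => mul_nonneg (hB0 β hβ0 hβ1) (Real.rpow_nonneg (hlen0 y) _)) hF hs.tri hs.symm hs.lenpos hαδ hδ₁ (by rw [abs_one]; norm_num)
      (fun z b => hs.KCt_nonneg i z b) (fun z b hzb => hs.KCt_loc i z b hzb) hCcol hleg (hi.hCt i)
  have hPsum := hasMajorantHom_finsetSum (R := R) (H := H) (Finset.univ : Finset Dir) 𝔬.blk 𝔭.blkPX
    (fun μ => (𝔭.ΦX U β ∘ₗ ((mulOp (𝔬.h i) * 𝔬.Gsq U i) ∘ₗ 𝔡.Dsd U μ)) ∘ₗ 𝔩.Pt U i μ) _ (fun μ _ => hPterm μ)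
  have hall := hasMajorantHom_add (g := toB6 g R H) 𝔬.blk 𝔭.blkPX hPsum hCterm
  rw [phiX_mulOp_Gsq_koptDir_eq]
  refine hasMajorantHom_mono (g := toB6 g R H) _ _ hall fun y y' => le_of_eq ?_
  have hy' : 0 < g.len y' := hs.lenpos y'
  have hm1 : g.len y' ^ ((0 : ℝ) - 1) = (g.len y')⁻¹ := by rw [zero_sub, Real.rpow_neg_one]
  have hm2 : g.len y' ^ ((1 : ℝ) - 2) = (g.len y')⁻¹ := by norm_num; exact Real.rpow_neg_one (g.len y')
  have ha0 : |(0 : ℝ)| = 0 := abs_zero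
  have ha1 : |(1 : ℝ)| = 1 := abs_one
  simp only [Finset.sum_const, Finset.card_univ, nsmul_eq_mul, hm1, hm2, ha0, ha1, Real.rpow_zero, Real.rpow_one]
  ring

end HolderV

end

end Literature.MathematicalPhysics.QuantumFieldTheory.Balaban1983to89.B9RWSums343HolderVFromLegs
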